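import Summits.KontsevichZagierPeriods.Zeta5Search.Barrier.ConeGammaLogCusp
import Summits.KontsevichZagierPeriods.Zeta5Search.Barrier.ConeGammaDelta28Lipschitz
import Summits.KontsevichZagierPeriods.Zeta5Search.Barrier.ConeGammaRates

/-!
# ζ(5) search — BARRIER: `γ` INHERITS the log-cusp of `Φ` (conditional on local Lipschitz `C₀`, `C₁`)

HONEST FRAMING (cell `pub-zeta5`): systematic search; no irrationality claim unless kernel-certified. MODEL objects
under Brown–Zudilin's (28)+(30) accounting ([BZ22] = arXiv:2210.03391); nothing here is a statement about `ζ(5)` or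
about the cone's supremum (C2 = `BarrierC2` stays OPEN; the lemma S-E stays CONJECTURED); no number of record moves;
records in print UNMOVED. Prover P2 g19 (sequel of `ConeGammaLogCusp`; source: P2 g11 `SE-STRUCTURE.md` §3 Cor. 2).

SE-STRUCTURE §3 Cor. 2: «if C₀, C₁ are Lipschitz near t₀ — automatic for δ₂₈, and true for C₀, C₁ at a Regular
t₀ by the implicit function theorem (NOT in the tree) — then γ₂₈(t₀+εv) − γ₂₈(t₀) = (∂γ/∂Φ)·S(v)·ε ln(1/ε) + O(ε)
with ∂γ/∂Φ = (C₁ − C₀)/Q²». Here the Lipschitz behaviour of `C₁`, `C₀` ALONG THE RAY is taken as a HYPOTHESIS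
(two one-sided bounds `|C_i(s(a)+εδ) − C_i(s(a))| ≤ L·ε` for small `ε`), `δ₂₈`'s is the tree's
`abs_delta28_sub_le_sParam` (`L_δ = 10`), and `Φ`'s expansion is `phi30_logCusp_openBox`:

* `mul_log_inv_le_two_sqrt`, `mul_log_inv_sq_le_four` — `ε·log(1/ε) ≤ 2√ε`, `ε·log(1/ε)² ≤ 4` (`ε > 0`);
* `abs_div_perturb_sub_le` — the algebra of `(N+ΔN)/(Q+ΔQ) − N/Q − (N/Q²)·m` when `ΔQ = −m + r`, `|ΔQ| ≤ Q/2`;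
* **`gamma_logCusp_of_lipschitz`** — on the open box, with period `T`, displacement `δ`, `Q = C₁ + δ₂₈ − Φ > 0` at
  `a`, and the Lipschitz hypothesis: `∃ σ C' ε₄ > 0` (`σ` = the slope of `phi30_logCusp`, characterised by Lemma B)
  with **`|γ(s(a)+εδ) − γ(a) − ((C₁−C₀)/Q²)·(σ/T)·ε·log(1/ε)| ≤ C'·ε`** for `0 < ε ≤ ε₄`.
READING: where the slope `σ` is non-zero and `C₀, C₁` are locally Lipschitz, `γ` has a log-cusp with coefficient
`(C₁−C₀)σ/(TQ²)` — so such a direction is NOT a point of differentiability of `γ`, and (Cor. 2's «only if») a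
direction with `σ(δ) > 0` for some `δ` and `C₁ > C₀` is not a local maximiser of `γ`. NOT here (honest): the Lipschitz
property of `C₀`, `C₁` at any direction (IFT on BZ's critical system — not in the tree), the sign of `σ` anywhere,
any constant of record, anything about C2 or `ζ(5)`.
-/

noncomputable section

open Set MeasureTheory
open scoped Topology

namespace Summit.KontsevichZagierPeriods.Zeta5Search.Barrier.ConeGamma

/-! ### Two elementary bounds on `ε·log(1/ε)` -/

/-- `ε·log(1/ε) ≤ 2√ε` for `ε > 0`. -/
theorem mul_log_inv_le_two_sqrt {ε : ℝ} (hε : 0 < ε) : ε * Real.log (1 / ε) ≤ 2 * Real.sqrt ε := by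
  have h := Real.log_le_rpow_div (show (0 : ℝ) ≤ 1 / ε by positivity) (show (0 : ℝ) < 1 / 2 by norm_num)
  rw [← Real.sqrt_eq_rpow, one_div, Real.sqrt_inv] at h
  -- h : log ε⁻¹ ≤ (√ε)⁻¹ / (1/2)
  have hs : 0 < Real.sqrt ε := Real.sqrt_pos.mpr hε
  have h2 : Real.log (1 / ε) ≤ 2 / Real.sqrt ε := by
    rw [one_div]; calc Real.log ε⁻¹ ≤ (Real.sqrt ε)⁻¹ / (1 / 2) := h
      _ = 2 / Real.sqrt ε := by field_simp
  calc ε * Real.log (1 / ε) ≤ ε * (2 / Real.sqrt ε) := mul_le_mul_of_nonneg_left h2 hε.le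
    _ = 2 * (ε / Real.sqrt ε) := by ring
    _ = 2 * Real.sqrt ε := by rw [Real.div_sqrt]

/-- `ε·log(1/ε)² ≤ 4` for `0 < ε ≤ 1`. -/
theorem mul_log_inv_sq_le_four {ε : ℝ} (hε : 0 < ε) (hε1 : ε ≤ 1) : ε * Real.log (1 / ε) ^ 2 ≤ 4 := by
  have hs : 0 < Real.sqrt ε := Real.sqrt_pos.mpr hε
  have h1 : Real.sqrt ε * Real.log (1 / ε) ≤ 2 := by
    have h := mul_log_inv_le_two_sqrt hε
    have : Real.sqrt ε * (Real.sqrt ε * Real.log (1 / ε)) ≤ Real.sqrt ε * 2 := by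
      rw [← mul_assoc, Real.mul_self_sqrt hε.le]; linarith
    exact le_of_mul_le_mul_left this hs
  have hpos : 0 ≤ Real.log (1 / ε) := Real.log_nonneg (by rw [le_div_iff₀ hε]; linarith)
  have hx : 0 ≤ Real.sqrt ε * Real.log (1 / ε) := mul_nonneg hs.le hpos
  calc ε * Real.log (1 / ε) ^ 2 = (Real.sqrt ε * Real.log (1 / ε)) ^ 2 := by
        rw [mul_pow, Real.sq_sqrt hε.le]
    _ ≤ 2 ^ 2 := pow_le_pow_left₀ hx h1 2
    _ = 4 := by norm_num

/-! ### Algebra of a perturbed quotient -/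

/-- **Perturbing a quotient.** If `Q > 0`, `|ΔQ| ≤ Q/2` and `ΔQ = −m + r`, then
`|(N+ΔN)/(Q+ΔQ) − N/Q − (N/Q²)·m| ≤ 2|N||m||ΔQ|/Q³ + 2(|ΔN|·Q + |N||r|)/Q²`. -/
theorem abs_div_perturb_sub_le {N Q ΔN ΔQ m r : ℝ} (hQ : 0 < Q) (hΔQ : |ΔQ| ≤ Q / 2)
    (hsplit : ΔQ = -m + r) :
    |(N + ΔN) / (Q + ΔQ) - N / Q - N / Q ^ 2 * m|
      ≤ 2 * |N| * |m| * |ΔQ| / Q ^ 3 + 2 * (|ΔN| * Q + |N| * |r|) / Q ^ 2 := by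
  have hQ' : Q / 2 ≤ Q + ΔQ := by have := neg_abs_le ΔQ; linarith
  have hQ'pos : 0 < Q + ΔQ := by linarith
  have hid : (N + ΔN) / (Q + ΔQ) - N / Q - N / Q ^ 2 * m
      = -(N * m * ΔQ) / (Q ^ 2 * (Q + ΔQ)) + (ΔN * Q - N * r) / (Q * (Q + ΔQ)) := by
    have hne : Q + ΔQ ≠ 0 := hQ'pos.ne'
    have hQne : Q ≠ 0 := hQ.ne'
    have hr : r = ΔQ + m := by rw [hsplit]; ring
    rw [hr]
    field_simp
    ring
  rw [hid]
  refine (abs_add_le _ _).trans (add_le_add ?_ ?_)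
  · rw [abs_div, abs_neg, abs_mul, abs_mul, abs_mul, abs_of_pos (pow_pos hQ 2), abs_of_pos hQ'pos]
    calc |N| * |m| * |ΔQ| / (Q ^ 2 * (Q + ΔQ)) ≤ |N| * |m| * |ΔQ| / (Q ^ 2 * (Q / 2)) :=
          div_le_div_of_nonneg_left (by positivity) (by positivity)
            (mul_le_mul_of_nonneg_left hQ' (pow_pos hQ 2).le)
      _ = 2 * |N| * |m| * |ΔQ| / Q ^ 3 := by field_simp
  · rw [abs_div, abs_mul, abs_of_pos hQ, abs_of_pos hQ'pos]
    have hnum : |ΔN * Q - N * r| ≤ |ΔN| * Q + |N| * |r| := by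
      calc |ΔN * Q - N * r| ≤ |ΔN * Q| + |N * r| := abs_sub _ _
        _ = |ΔN| * Q + |N| * |r| := by rw [abs_mul, abs_mul, abs_of_pos hQ]
    calc |ΔN * Q - N * r| / (Q * (Q + ΔQ)) ≤ (|ΔN| * Q + |N| * |r|) / (Q * (Q / 2)) :=
          div_le_div₀ (by positivity) hnum (by positivity) (mul_le_mul_of_nonneg_left hQ' hQ.le)
      _ = 2 * (|ΔN| * Q + |N| * |r|) / Q ^ 2 := by field_simp

/-! ### `γ` inherits the log-cusp -/

/-- **`γ` INHERITS THE LOG-CUSP OF `Φ` (SE-STRUCTURE §3 Cor. 2, conditional kernel form).** On the open box, with a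
period `T`, a displacement `δ`, a positive denominator `Q = C₁ + δ₂₈ − Φ` at `a`, and ASSUMING that `C₁` and `C₀` are
Lipschitz along the ray (`|C_i(s(a)+εδ) − C_i(a)| ≤ L·ε` for `0 < ε ≤ ε₃` — true at a Regular direction by the
implicit function theorem on BZ's critical system, which is NOT in the tree): there are `σ` (the slope of
`phi30_logCusp`, characterised by Lemma B), `C'` and `ε₄ > 0` with
`|γ(s(a)+εδ) − γ(a) − ((C₁−C₀)/Q²)·(σ/T)·ε·log(1/ε)| ≤ C'·ε` for all `0 < ε ≤ ε₄`. -/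
theorem gamma_logCusp_of_lipschitz {a : Dir}
    (hopen : ∀ j : Fin 7, 0 < sParam a j.succ ∧ sParam a j.succ < sParam a 0)
    {T : ℝ} (hT : 0 < T) (hper : ∀ k : Fin 28, ∃ z : ℤ, T * h28 a k = z) (δ : Fin 8 → ℝ)
    (hQ : 0 < C1 a + delta28 a - phi30 a) {L ε₃ : ℝ} (hL : 0 ≤ L) (hε₃ : 0 < ε₃)
    (hC1 : ∀ ε, 0 < ε → ε ≤ ε₃ → |C1 (aOfS (sParam a + ε • δ)) - C1 a| ≤ L * ε)
    (hC0 : ∀ ε, 0 < ε → ε ≤ ε₃ → |C0 (aOfS (sParam a + ε • δ)) - C0 a| ≤ L * ε) :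
    ∃ σ C' ε₄ : ℝ, 0 < ε₄ ∧
      (∀ ρ, 0 < ρ → ρ * clusterBound a δ < 1 → ρ * clusterBound a δ < wallDist a T →
        (∀ m, m + 1 < (bkpts a T).card → 2 * ρ * clusterWidth a δ ≤ bkpt a T (m + 1) - bkpt a T m) →
        translateIntegral a T (ρ • δ) - translateIntegral a T 0 = ρ * σ) ∧
      ∀ ε, 0 < ε → ε ≤ ε₄ →
        |gamma (aOfS (sParam a + ε • δ)) - gamma a
          - (C1 a - C0 a) / (C1 a + delta28 a - phi30 a) ^ 2 * (σ / T) * ε * Real.log (1 / ε)| ≤ C' * ε := by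
  obtain ⟨σ, C, ε₁, hε₁, hslope, hexp⟩ := phi30_logCusp_openBox hopen hT hper δ
  -- size of the displacement in the symmetric parameters
  obtain ⟨D, hD0, hD⟩ : ∃ D : ℝ, 0 ≤ D ∧ ∀ i : Fin 8, |δ i| ≤ D :=
    ⟨(Finset.univ : Finset (Fin 8)).sup' Finset.univ_nonempty fun i => |δ i|,
      (abs_nonneg (δ 0)).trans (Finset.le_sup' (fun i => |δ i|) (Finset.mem_univ 0)),
      fun i => Finset.le_sup' (fun i => |δ i|) (Finset.mem_univ i)⟩
  have hCnn : 0 ≤ C := by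
    -- from the expansion at `ε = ε₁`: `0 ≤ |…| ≤ C ε₁`
    have h := hexp ε₁ hε₁ le_rfl
    nlinarith [abs_nonneg (phi30 (aOfS (sParam a + ε₁ • δ)) - phi30 a - σ / T * ε₁ * Real.log (1 / ε₁))]
  -- names
  obtain ⟨N, hN⟩ : ∃ N : ℝ, N = C1 a - C0 a := ⟨_, rfl⟩
  obtain ⟨Q, hQdef⟩ : ∃ Q : ℝ, Q = C1 a + delta28 a - phi30 a := ⟨_, rfl⟩
  rw [← hQdef] at hQ
  obtain ⟨A, hA⟩ : ∃ A : ℝ, A = 2 * |σ| / T + (L + 10 * D + C) := ⟨_, rfl⟩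
  have hA0 : 0 ≤ A := by rw [hA]; positivity
  obtain ⟨C', hC'⟩ : ∃ C' : ℝ, C' = 2 * |N| * (4 * (σ / T) ^ 2 + 2 * (|σ| / T) * (L + 10 * D + C)) / Q ^ 3
      + 2 * (2 * L * Q + |N| * (L + 10 * D + C)) / Q ^ 2 := ⟨_, rfl⟩
  obtain ⟨ε₄, hε₄⟩ : ∃ ε₄ : ℝ, ε₄ = min (min ε₁ ε₃) (min 1 ((Q / (2 * A + 1)) ^ 2)) := ⟨_, rfl⟩
  have hε₄pos : 0 < ε₄ := by
    rw [hε₄]; exact lt_min (lt_min hε₁ hε₃) (lt_min one_pos (by positivity))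
  refine ⟨σ, C', ε₄, hε₄pos, hslope, fun ε hε hεle => ?_⟩
  rw [hε₄] at hεle
  have hε1 : ε ≤ ε₁ := hεle.trans ((min_le_left _ _).trans (min_le_left _ _))
  have hε3 : ε ≤ ε₃ := hεle.trans ((min_le_left _ _).trans (min_le_right _ _))
  have hεone : ε ≤ 1 := hεle.trans ((min_le_right _ _).trans (min_le_left _ _))
  have hεsq : ε ≤ (Q / (2 * A + 1)) ^ 2 := hεle.trans ((min_le_right _ _).trans (min_le_right _ _))
  -- the perturbations
  obtain ⟨a', ha'⟩ : ∃ a' : Dir, a' = aOfS (sParam a + ε • δ) := ⟨_, rfl⟩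
  rw [← ha']
  obtain ⟨ΔC1, hΔC1⟩ : ∃ x : ℝ, x = C1 a' - C1 a := ⟨_, rfl⟩
  obtain ⟨ΔC0, hΔC0⟩ : ∃ x : ℝ, x = C0 a' - C0 a := ⟨_, rfl⟩
  obtain ⟨Δδ, hΔδ⟩ : ∃ x : ℝ, x = delta28 a' - delta28 a := ⟨_, rfl⟩
  obtain ⟨Λ, hΛ⟩ : ∃ x : ℝ, x = Real.log (1 / ε) := ⟨_, rfl⟩
  obtain ⟨m, hm⟩ : ∃ x : ℝ, x = σ / T * ε * Λ := ⟨_, rfl⟩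
  obtain ⟨r', hr'⟩ : ∃ x : ℝ, x = phi30 a' - phi30 a - m := ⟨_, rfl⟩
  obtain ⟨B, hB⟩ : ∃ x : ℝ, x = L + 10 * D + C := ⟨_, rfl⟩
  have hB0 : 0 ≤ B := by rw [hB]; linarith
  have hb1 : |ΔC1| ≤ L * ε := by rw [hΔC1, ha']; exact hC1 ε hε hε3
  have hb0 : |ΔC0| ≤ L * ε := by rw [hΔC0, ha']; exact hC0 ε hε hε3
  have hbδ : |Δδ| ≤ 10 * (ε * D) := by
    rw [hΔδ]
    refine abs_delta28_sub_le_sParam fun i => ?_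
    rw [ha', sParam_aOfS, Pi.add_apply, Pi.smul_apply, smul_eq_mul, add_sub_cancel_left, abs_mul,
      abs_of_pos hε]
    exact mul_le_mul_of_nonneg_left (hD i) hε.le
  have hbr : |r'| ≤ C * ε := by rw [hr', hm, hΛ, ha']; exact hexp ε hε hε1
  have hΛ0 : 0 ≤ Λ := by rw [hΛ]; exact Real.log_nonneg (by rw [le_div_iff₀ hε]; linarith)
  have hεΛ : ε * Λ ≤ 2 * Real.sqrt ε := by rw [hΛ]; exact mul_log_inv_le_two_sqrt hε
  have hεΛ2 : ε * Λ ^ 2 ≤ 4 := by rw [hΛ]; exact mul_log_inv_sq_le_four hε hεone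
  have hsqrt1 : Real.sqrt ε ≤ 1 := by rw [← Real.sqrt_one]; exact Real.sqrt_le_sqrt hεone
  have hsqrtQ : Real.sqrt ε ≤ Q / (2 * A + 1) := by
    rw [← Real.sqrt_sq (show 0 ≤ Q / (2 * A + 1) by positivity)]; exact Real.sqrt_le_sqrt hεsq
  have hεsqrt : ε ≤ Real.sqrt ε := by
    calc ε = Real.sqrt ε * Real.sqrt ε := (Real.mul_self_sqrt hε.le).symm
      _ ≤ Real.sqrt ε * 1 := mul_le_mul_of_nonneg_left hsqrt1 (Real.sqrt_nonneg _)
      _ = Real.sqrt ε := mul_one _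
  have hu2 : ε * Λ ≤ 2 := hεΛ.trans (by linarith)
  have habsm : |m| = |σ| / T * (ε * Λ) := by
    rw [hm, abs_mul, abs_mul, abs_div, abs_of_pos hT, abs_of_pos hε, abs_of_nonneg hΛ0]; ring
  have hm0 : 0 ≤ |m| := abs_nonneg m
  have hσT : 0 ≤ |σ| / T := div_nonneg (abs_nonneg σ) hT.le
  -- the quotient data
  have hΔQsplit : ΔC1 + Δδ - (phi30 a' - phi30 a) = -m + (ΔC1 + Δδ - r') := by rw [hr']; ring
  have hrb : |ΔC1 + Δδ - r'| ≤ B * ε := by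
    calc |ΔC1 + Δδ - r'| ≤ |ΔC1 + Δδ| + |r'| := abs_sub _ _
      _ ≤ |ΔC1| + |Δδ| + |r'| := add_le_add (abs_add_le _ _) le_rfl
      _ ≤ L * ε + 10 * (ε * D) + C * ε := add_le_add (add_le_add hb1 hbδ) hbr
      _ = B * ε := by rw [hB]; ring
  have hΔQb : |ΔC1 + Δδ - (phi30 a' - phi30 a)| ≤ A * Real.sqrt ε := by
    rw [hΔQsplit]
    calc |-m + (ΔC1 + Δδ - r')| ≤ |-m| + |ΔC1 + Δδ - r'| := abs_add_le _ _
      _ = |m| + |ΔC1 + Δδ - r'| := by rw [abs_neg]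
      _ ≤ |σ| / T * (2 * Real.sqrt ε) + B * Real.sqrt ε := by
          rw [habsm]
          exact add_le_add (mul_le_mul_of_nonneg_left hεΛ hσT)
            (hrb.trans (mul_le_mul_of_nonneg_left hεsqrt hB0))
      _ = A * Real.sqrt ε := by rw [hA, hB]; ring
  have hΔQhalf : |ΔC1 + Δδ - (phi30 a' - phi30 a)| ≤ Q / 2 := by
    refine hΔQb.trans ?_
    have hAq : A * (Q / (2 * A + 1)) ≤ Q / 2 := by
      rw [mul_div_assoc', div_le_div_iff₀ (by linarith) two_pos]; nlinarith
    exact (mul_le_mul_of_nonneg_left hsqrtQ hA0).trans hAq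
  -- γ in terms of the perturbations
  have hγ : gamma a' - gamma a - (C1 a - C0 a) / (C1 a + delta28 a - phi30 a) ^ 2 * (σ / T) * ε * Real.log (1 / ε)
      = (N + (ΔC1 - ΔC0)) / (Q + (ΔC1 + Δδ - (phi30 a' - phi30 a))) - N / Q - N / Q ^ 2 * m := by
    unfold gamma
    rw [← hQdef, ← hN, hm, hΛ]
    have e1 : C1 a' - C0 a' = N + (ΔC1 - ΔC0) := by rw [hN, hΔC1, hΔC0]; ring
    have e2 : C1 a' + delta28 a' - phi30 a' = Q + (ΔC1 + Δδ - (phi30 a' - phi30 a)) := by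
      rw [hQdef, hΔC1, hΔδ]; ring
    rw [e1, e2]; ring
  rw [hγ]
  refine (abs_div_perturb_sub_le hQ hΔQhalf hΔQsplit).trans ?_
  -- bound the two terms
  have hΔN : |ΔC1 - ΔC0| ≤ 2 * L * ε := by
    calc |ΔC1 - ΔC0| ≤ |ΔC1| + |ΔC0| := abs_sub _ _
      _ ≤ L * ε + L * ε := add_le_add hb1 hb0
      _ = 2 * L * ε := by ring
  have hm2 : |m| * |m| ≤ (σ / T) ^ 2 * (4 * ε) := by
    rw [habsm]
    have e : |σ| / T * (ε * Λ) * (|σ| / T * (ε * Λ)) = (|σ| / T) ^ 2 * (ε * (ε * Λ ^ 2)) := by ring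
    rw [e, div_pow, sq_abs, ← div_pow]
    refine mul_le_mul_of_nonneg_left ?_ (sq_nonneg _)
    have := mul_le_mul_of_nonneg_left hεΛ2 hε.le
    linarith
  have hm1 : |m| * (B * ε) ≤ |σ| / T * 2 * (B * ε) := by
    refine mul_le_mul_of_nonneg_right ?_ (mul_nonneg hB0 hε.le)
    rw [habsm]
    exact mul_le_mul_of_nonneg_left hu2 hσT
  have hmΔQ : |m| * |ΔC1 + Δδ - (phi30 a' - phi30 a)| ≤ ε * (4 * (σ / T) ^ 2 + 2 * (|σ| / T) * B) := by
    rw [hΔQsplit]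
    have h1 : |-m + (ΔC1 + Δδ - r')| ≤ |m| + B * ε := by
      calc _ ≤ |-m| + |ΔC1 + Δδ - r'| := abs_add_le _ _
        _ ≤ |m| + B * ε := by rw [abs_neg]; exact add_le_add le_rfl hrb
    calc |m| * |-m + (ΔC1 + Δδ - r')| ≤ |m| * (|m| + B * ε) := mul_le_mul_of_nonneg_left h1 hm0
      _ = |m| * |m| + |m| * (B * ε) := by ring
      _ ≤ (σ / T) ^ 2 * (4 * ε) + |σ| / T * 2 * (B * ε) := add_le_add hm2 hm1
      _ = ε * (4 * (σ / T) ^ 2 + 2 * (|σ| / T) * B) := by ring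
  have hN0 : 0 ≤ |N| := abs_nonneg N
  have hQ2 : 0 < Q ^ 2 := pow_pos hQ 2
  have hQ3 : 0 < Q ^ 3 := pow_pos hQ 3
  calc 2 * |N| * |m| * |ΔC1 + Δδ - (phi30 a' - phi30 a)| / Q ^ 3
        + 2 * (|ΔC1 - ΔC0| * Q + |N| * |ΔC1 + Δδ - r'|) / Q ^ 2
      ≤ 2 * |N| * (ε * (4 * (σ / T) ^ 2 + 2 * (|σ| / T) * B)) / Q ^ 3
        + 2 * (2 * L * ε * Q + |N| * (B * ε)) / Q ^ 2 := by
        refine add_le_add ?_ ?_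
        · refine div_le_div_of_nonneg_right ?_ hQ3.le
          rw [mul_assoc (2 * |N|)]
          exact mul_le_mul_of_nonneg_left hmΔQ (by positivity)
        · refine div_le_div_of_nonneg_right (mul_le_mul_of_nonneg_left (add_le_add
            (mul_le_mul_of_nonneg_right hΔN hQ.le) (mul_le_mul_of_nonneg_left hrb hN0)) (by norm_num)) hQ2.le
    _ = C' * ε := by rw [hC', hB]; field_simp

end Summit.KontsevichZagierPeriods.Zeta5Search.Barrier.ConeGamma

end
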